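import Summits.QuantumFields.BalabanUV.Beta.GAN24.StepCovarianceSandwichApply
import Summits.QuantumFields.BalabanUV.Beta.GAN24.ValueHessianCellAdjoint
import Summits.QuantumFields.BalabanUV.Beta.GAN24.ContourSumCellAdjoint
import Summits.QuantumFields.BalabanUV.Beta.GAN24.EEWordReduced

/-!
# `BalabanUV.Beta.GAN24.StepCovarianceCellPairingTent` — binder row G-an2-4 ∕ (CONV-C), conservation law (C) AT LEVELS `j ≥ 1`, the (γ) hand's «DEPTH TOWER»
# (memo `HOME/b2b-balaban-gan24-formalise-leaf-06/g54/C-LEVELS-GE1-g54.md` §29, letter K5): **THE E2–X̃–E2 CHANNEL ON A DEEP CELL, TENT KEPT** — for bounded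
# field-leg profiles `qL`, `qR` of period `Lc·N` (every `j`, in-block root `toSite r`, every `d`, `Lc ≥ 1`, `N ≥ 1`):
# `Σ_{x ∈ box (Lc·N)} Σ_a (E2ᵀqL)(a,x)·(X̃_{j+1}(E2 qR))(a,x) = sf²·wVH_{j+1}⁻¹·[ Σ_{x ∈ box (Lc·N)} Σ_b qL_b(x)·(E2_{j+1} qR)(b,x)
#   − Σ_{y ∈ box N} Σ_a (𝒬qL)_a(y)·(E2_{j+2}ᵀ(𝒬qR))(a,y) ]` (`sum_box_E2T_mul_dressedStep_E2_apply_tent`).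

NOT IN PRINT; OUR BOOKKEEPING ([folklore] BY NAME over this lineage's L4 `StepCovarianceSandwich.sandwich_inl_inl` (`E2·G·E2 = wVH⁻¹·(E2 − 𝒬ᵀ E2′ 𝒬)` on the
`inl/inl` block) and L4′ `StepCovarianceSandwichApply` (`tsum_comp_apply_bdd`, `abs_apply_bdd_le`, `summable_apply_bdd`, `summable_tentCol_mul`, `tsum_tent_apply_eq`),
`ValueHessianCellAdjoint.sum_box_E2apply_mul_periodic'` (cell adjointness of `E2`), `ContourSumCellAdjoint.sum_box_mul_contourSumAdj` (cell adjointness of `𝒬ᵀ`),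
leaf-04's `EEWordReduced.shiftK_dressedStep`, an2's `HessKerDressedUnits.unitK`; G-an2-4 formalisation swarm, leaf prover `b2b-balaban-gan24-formalise-leaf-06`, gen 54).
HONEST FRAMING (cell contract, verbatim): «discharging `BetaPertH` makes Bałaban's UV stability UNCONDITIONAL — a real constructive-QFT result; it is NOT the continuum
limit and NOT the Clay problem.»  HONEST DEPENDENCY (verbatim): «continuum YM on T⁴ ⇐ BetaPertH ∧ nine spine estimates (0/9 proved); BetaPertH ⇐ (D1) ∧ (D4) ∧ CAP+tail;
G-an2-4 gates asym, D1 and NE2/3/4.»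

WHY (the located use, memo §29): the (γ) hand's gen-52 cell pairing `ExchangeE2E2ChannelValue.sum_box_E2T_mul_dressedStep_E2_apply` evaluates the E2–X̃–E2 channel on
the `Lc`-cell for profiles with ZERO block contour sums, where the tent term of the one-step covariance drops.  The depth tower reads the same channel on profiles of
period `Lc·N` (pre-images of face classes `[t % (Lc·N) = Lc·N − 1]`), whose contour sums do NOT vanish: the tent survives and — by the two cell adjointness moves —
lands as the SAME KIND of pairing one level up (`E2_{j+2}` against the block contour sums `𝒬qL`, `𝒬qR`, on the coarse cell of period `N`).  With
`DeepProfileContourSum.contourSum_deepProfile` (`𝒬 q^{(Lc·N)} = Lc^{d+1}·q^{(N)}`) this is the level bridge of the tower.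

MECHANISM: §1 the sandwich kernel `E2_{j+1}·G_{j+1}·E2_{j+1}` (dressed step covariance `G_{j+1} = coDressKBmAt (toSite r) Lc (KInvStep Lc (j+1))`) against
bounded field-leg data `h`, TENT KEPT: `= wVH⁻¹·(E2_{j+1}h − 𝒬ᵀ[E2_{j+2}ᵀ(𝒬h)])` (`tsum_sandwich_apply`; iterated form `tsum_E2_G_E2_apply` by two Fubini steps, exactly
as in L4′; through the field-leg units `tsum_E2_unitK_E2_apply`); §2 re-indexing lemmas at period `Lc·N` (the dressed step kernel on `Lc·N`-periodic data is
`Lc·N`-periodic, `dressedStep_apply_periodic_mul`; block contour sums of `Lc·N`-periodic data are `N`-periodic, `contourSum_translate_of_periodic`); §3 the cell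
pairing: `E2`'s cell adjointness moves the left `E2` onto the right factor, §1 evaluates the point values, `𝒬ᵀ`'s cell adjointness moves the tent onto the coarse cell;
§4 on profiles with proportional block contour sums (`𝒬q = c·Q`) the tent IS the same kind of pairing one level up (`sum_box_tent_of_contourSum_eq`,
`sum_box_E2T_mul_dressedStep_E2_apply_bridge`).

WHAT ([folklore]; 0 `def`, 0 cited facts, 0 `def … : Prop`, 0 sorry): the theorems named above.  Asserts NO value of Bałaban's tables; discharges NOTHING of (C) ∕ (C)sym
∕ (Q-D); NOT 33_j, NOT the tower's prefactor identities, NEVER «G-an2-4 closed» as (CONV-C); NOT D1, NOT `BetaPertH`, NOT continuum, NOT Clay.  2026-08-24; no existing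
file touched.
-/

noncomputable section

open Finset
open scoped BigOperators
open Literature.MathematicalPhysics.QuantumFieldTheory
open Literature.MathematicalPhysics.QuantumFieldTheory.Balaban1983to89
open Literature.MathematicalPhysics.QuantumFieldTheory.Balaban1983to89.Beta
open B12Sec2to5 (l1 l1_nonneg)
open ExpKernelCalculus (Site MKer Decays comp shiftK Zl Zl_nonneg)
open AffineAveraging (Form1 box toSite contourSum unitVec)
open AffineReproduction (contourSumAdj)
open OneStepResolventKernel (Fib)
open OneStepKernelFamily (KInvStep decays_KInvStep)
open BalabanStepJetsSucc (E2 wVH decays_E2)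
open Summit.QuantumFields.BalabanUV.Beta.TameKernelCalculus
open Summit.QuantumFields.BalabanUV.Beta.AxialDressingRooted (coDressKBmAt decays_coDressKBmAt_KInvStep one_le_of_neZero)
open Summit.QuantumFields.BalabanUV.Beta.BorderedHessian (E2_inl_inr E2_inr E2_inl_inl_eq_wΦ)
open Summit.QuantumFields.BalabanUV.Beta.HessKerDressedUnits (unitK unitK_apply legScale_inl)
open Summit.QuantumFields.BalabanUV.Beta.GAN24.TransverseDictionary (wΦ_symm)
open Summit.QuantumFields.BalabanUV.Beta.GAN24.StepCovarianceSandwich (sandwich_inl_inl)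
open Summit.QuantumFields.BalabanUV.Beta.GAN24.StepCovarianceSandwichApply (summable_apply_bdd abs_apply_bdd_le tsum_comp_apply_bdd summable_tentCol_mul
  tsum_tent_apply_eq)
open Summit.QuantumFields.BalabanUV.Beta.GAN24.ValueHessianCellAdjoint (E2_inl_inl_translate sum_box_E2apply_mul_periodic')
open Summit.QuantumFields.BalabanUV.Beta.GAN24.ContourSumCellAdjoint (sum_box_mul_contourSumAdj)
open Summit.QuantumFields.BalabanUV.Beta.GAN24.EEWordReduced (shiftK_dressedStep)

namespace Summit.QuantumFields.BalabanUV.Beta.GAN24.StepCovarianceCellPairingTent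

variable {d : ℕ} {Lc : ℕ} [NeZero Lc]

/-! ## §1 The sandwich against bounded field-leg data, tent kept -/

/-- [folklore] The outer tent row `z ↦ Σ_b 𝒬ᵀ[m,y′ ↦ 𝒬ᵀ[κ′,y″ ↦ E2_{j′}(y″,y′)_{κ′m}](b,z)](a,x)·h b z` against bounded data is summable (a finite sum of the inner
columns `StepCovarianceSandwichApply.summable_tentCol_mul`). -/
theorem summable_tentRow_mul (j' : ℕ) {h : Fin (d + 1) → Site (d + 1) → ℝ} {B : ℝ} (hh : ∀ b z, |h b z| ≤ B) (x : Site (d + 1)) (a : Fin (d + 1)) :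
    Summable fun z : Site (d + 1) => ∑ b : Fin (d + 1),
      contourSumAdj Lc (fun m y' => contourSumAdj Lc (fun κ' y'' => E2 d Lc j' y'' y' (Sum.inl κ') (Sum.inl m)) b z) a x * h b z := by
  have e1 : ∀ z, (∑ b : Fin (d + 1),
      contourSumAdj Lc (fun m y' => contourSumAdj Lc (fun κ' y'' => E2 d Lc j' y'' y' (Sum.inl κ') (Sum.inl m)) b z) a x * h b z) =
      ∑ s ∈ Finset.range Lc, ∑ b : Fin (d + 1),
        contourSumAdj Lc (fun κ' y'' => E2 d Lc j' y'' (LatticeForm.quo Lc (x - (s : ℤ) • unitVec a)) (Sum.inl κ') (Sum.inl a)) b z * h b z := by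
    intro z
    rw [Finset.sum_comm]
    refine Finset.sum_congr rfl fun b _ => ?_
    rw [KKTFluctuationEnergy.contourSumAdj_eq, Finset.sum_mul]
  simp_rw [e1]
  exact summable_sum fun s _ => summable_tentCol_mul j' hh _ a

/-- [folklore] **THE SANDWICH KERNEL AGAINST BOUNDED FIELD-LEG DATA, TENT KEPT**: for bounded field-leg data `h` (every `j`, in-block root `toSite r`),
`Σ'_z Σ_b (E2_{j+1}·G_{j+1}·E2_{j+1})(x,z)_{inl a, inl b}·h b z
  = wVH_{j+1}⁻¹·Σ'_z Σ_b E2_{j+1}(x,z)_{ab}·h b z − wVH_{j+1}⁻¹·𝒬ᵀ[m,y′ ↦ Σ'_{y″} Σ_{κ′} E2_{j+2}(y″,y′)_{κ′m}·(𝒬h)(κ′,y″)](a,x)`. -/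
theorem tsum_sandwich_apply {r : Fin (d + 1) → ℕ} (hr : r ∈ box (d + 1) Lc) (j : ℕ) {h : Fin (d + 1) → Site (d + 1) → ℝ} {B : ℝ}
    (hh : ∀ b z, |h b z| ≤ B) (x : Site (d + 1)) (a : Fin (d + 1)) :
    (∑' z, ∑ b : Fin (d + 1),
        comp (comp (E2 d Lc (j + 1)) (coDressKBmAt (toSite r) Lc (KInvStep (d := d) Lc (j + 1)))) (E2 d Lc (j + 1)) x z (Sum.inl a) (Sum.inl b) *
          h b z) =
      (wVH d Lc (j + 1))⁻¹ * (∑' z, ∑ b : Fin (d + 1), E2 d Lc (j + 1) x z (Sum.inl a) (Sum.inl b) * h b z) -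
        (wVH d Lc (j + 1))⁻¹ *
          contourSumAdj Lc (fun m y' => ∑' y'', ∑ κ' : Fin (d + 1), E2 d Lc (j + 2) y'' y' (Sum.inl κ') (Sum.inl m) * contourSum Lc h κ' y'') a x := by
  obtain ⟨δ, C, hδ, -, hE⟩ := decays_E2 (d := d) (Lc := Lc) (j + 1)
  have e : ∀ z, (∑ b : Fin (d + 1),
      comp (comp (E2 d Lc (j + 1)) (coDressKBmAt (toSite r) Lc (KInvStep (d := d) Lc (j + 1)))) (E2 d Lc (j + 1)) x z (Sum.inl a) (Sum.inl b) *
        h b z) =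
      (wVH d Lc (j + 1))⁻¹ * (∑ b : Fin (d + 1), E2 d Lc (j + 1) x z (Sum.inl a) (Sum.inl b) * h b z) -
        (wVH d Lc (j + 1))⁻¹ * (∑ b : Fin (d + 1),
          contourSumAdj Lc (fun m y' => contourSumAdj Lc (fun κ' y'' => E2 d Lc (j + 2) y'' y' (Sum.inl κ') (Sum.inl m)) b z) a x * h b z) := by
    intro z
    rw [Finset.mul_sum, Finset.mul_sum, ← Finset.sum_sub_distrib]
    refine Finset.sum_congr rfl fun b _ => ?_
    rw [sandwich_inl_inl hr j x z a b]
    ring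
  rw [tsum_congr e, ((summable_apply_bdd hE hδ hh x (Sum.inl a)).mul_left _).tsum_sub ((summable_tentRow_mul (j + 2) hh x a).mul_left _),
    tsum_mul_left, tsum_mul_left, tsum_tent_apply_eq (j + 2) hh x a]

/-- [folklore] **THE ITERATED FORM** (two Fubini steps, as in L4′): for bounded field-leg data `h`,
`Σ'_y Σ_l E2_{j+1}(x,y)_{al}·Σ'_w Σ_{l′} G_{j+1}(y,w)_{ll′}·Σ'_z Σ_b E2_{j+1}(w,z)_{l′b}·h b z
  = wVH_{j+1}⁻¹·(E2_{j+1}h)(a,x) − wVH_{j+1}⁻¹·𝒬ᵀ[E2_{j+2}ᵀ(𝒬h)](a,x)`. -/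
theorem tsum_E2_G_E2_apply {r : Fin (d + 1) → ℕ} (hr : r ∈ box (d + 1) Lc) (j : ℕ) {h : Fin (d + 1) → Site (d + 1) → ℝ} {B : ℝ}
    (hh : ∀ b z, |h b z| ≤ B) (x : Site (d + 1)) (a : Fin (d + 1)) :
    (∑' y, ∑ l : Fin (d + 1), E2 d Lc (j + 1) x y (Sum.inl a) (Sum.inl l) *
        ∑' w, ∑ l' : Fin (d + 1), coDressKBmAt (toSite r) Lc (KInvStep (d := d) Lc (j + 1)) y w (Sum.inl l) (Sum.inl l') *
          ∑' z, ∑ b : Fin (d + 1), E2 d Lc (j + 1) w z (Sum.inl l') (Sum.inl b) * h b z) =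
      (wVH d Lc (j + 1))⁻¹ * (∑' z, ∑ b : Fin (d + 1), E2 d Lc (j + 1) x z (Sum.inl a) (Sum.inl b) * h b z) -
        (wVH d Lc (j + 1))⁻¹ *
          contourSumAdj Lc (fun m y' => ∑' y'', ∑ κ' : Fin (d + 1), E2 d Lc (j + 2) y'' y' (Sum.inl κ') (Sum.inl m) * contourSum Lc h κ' y'') a x := by
  set E : MKer (d + 1) (Fib d) := E2 d Lc (j + 1) with hEdef
  set G : MKer (d + 1) (Fib d) := coDressKBmAt (toSite r) Lc (KInvStep (d := d) Lc (j + 1)) with hGdef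
  obtain ⟨δE, CE, hδE, hCE, hE⟩ := decays_E2 (d := d) (Lc := Lc) (j + 1)
  obtain ⟨δG, CG, hδG, hCG, hG⟩ := decays_coDressKBmAt_KInvStep (d := d) hr (j + 1)
  rw [← hEdef] at hE
  rw [← hGdef] at hG
  -- common rate and the decay of `E ∘ G`
  set δ₀ : ℝ := min δE δG with hδ₀
  have hδ₀0 : 0 < δ₀ := lt_min hδE hδG
  have hE' : Decays E (|CE|) δ₀ := decays_of_le hE (min_le_left _ _)
  have hG' : Decays G (|CG|) δ₀ := decays_of_le hG (min_le_right _ _)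
  have hEG : Decays (comp E G) _ (δ₀ / 2) := BalabanStepJetsSucc.decays_comp hE' hG' (half_pos hδ₀0).le (half_lt_self hδ₀0)
  -- the data `D := E·h` is bounded
  set D : Fin (d + 1) → Site (d + 1) → ℝ := fun l' w => ∑' z, ∑ b : Fin (d + 1), E w z (Sum.inl l') (Sum.inl b) * h b z with hD
  have hDb : ∀ l' w, |D l' w| ≤ ((d : ℝ) + 1) * (CE * B) * Zl (d + 1) δE := fun l' w => abs_apply_bdd_le hE hδE hh w (Sum.inl l')
  -- start from the sandwich kernel against `h`
  rw [← tsum_sandwich_apply hr j hh x a, ← hEdef, ← hGdef]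
  -- Fubini 1: `((E∘G)∘E)·h = (E∘G)·(E·h)`
  rw [tsum_comp_apply_bdd hEG (half_pos hδ₀0) hE hδE hh x (Sum.inl a)]
  -- only field fibres survive in the middle (`E` has no multiplier rows)
  have e1 : ∀ w, (∑ g : Fib d, comp E G x w (Sum.inl a) g * ∑' z, ∑ b : Fin (d + 1), E w z g (Sum.inl b) * h b z) =
      ∑ l' : Fin (d + 1), comp E G x w (Sum.inl a) (Sum.inl l') * D l' w := by
    intro w
    rw [Fintype.sum_sum_type]
    simp only [hD, hEdef, E2_inr, zero_mul, Finset.sum_const_zero, tsum_zero, mul_zero, add_zero]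
  rw [tsum_congr e1]
  -- Fubini 2: `(E∘G)·D = E·(G·D)`
  rw [tsum_comp_apply_bdd hE hδE hG hδG hDb x (Sum.inl a)]
  refine tsum_congr fun y => ?_
  rw [Fintype.sum_sum_type]
  simp only [hD, hEdef, E2_inl_inr, zero_mul, Finset.sum_const_zero, add_zero]

/-- [folklore] **… THROUGH THE FIELD-LEG UNITS**: with the unit-dressed step kernel `X̃_{j+1} = unitK sf sm G_{j+1}` in the middle the iterated form is `sf²` times the above. -/
theorem tsum_E2_unitK_E2_apply {r : Fin (d + 1) → ℕ} (hr : r ∈ box (d + 1) Lc) (sf sm : ℝ) (j : ℕ) {h : Fin (d + 1) → Site (d + 1) → ℝ} {B : ℝ}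
    (hh : ∀ b z, |h b z| ≤ B) (x : Site (d + 1)) (a : Fin (d + 1)) :
    (∑' y, ∑ l : Fin (d + 1), E2 d Lc (j + 1) x y (Sum.inl a) (Sum.inl l) *
        ∑' w, ∑ l' : Fin (d + 1), unitK sf sm (coDressKBmAt (toSite r) Lc (KInvStep (d := d) Lc (j + 1))) y w (Sum.inl l) (Sum.inl l') *
          ∑' z, ∑ b : Fin (d + 1), E2 d Lc (j + 1) w z (Sum.inl l') (Sum.inl b) * h b z) =
      (sf * sf) * ((wVH d Lc (j + 1))⁻¹ * (∑' z, ∑ b : Fin (d + 1), E2 d Lc (j + 1) x z (Sum.inl a) (Sum.inl b) * h b z) -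
        (wVH d Lc (j + 1))⁻¹ *
          contourSumAdj Lc (fun m y' => ∑' y'', ∑ κ' : Fin (d + 1), E2 d Lc (j + 2) y'' y' (Sum.inl κ') (Sum.inl m) * contourSum Lc h κ' y'') a x) := by
  rw [← tsum_E2_G_E2_apply hr j hh x a, ← tsum_mul_left]
  refine tsum_congr fun y => ?_
  rw [Finset.mul_sum]
  refine Finset.sum_congr rfl fun l _ => ?_
  have hin : (∑' w, ∑ l' : Fin (d + 1), unitK sf sm (coDressKBmAt (toSite r) Lc (KInvStep (d := d) Lc (j + 1))) y w (Sum.inl l) (Sum.inl l') *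
        ∑' z, ∑ b : Fin (d + 1), E2 d Lc (j + 1) w z (Sum.inl l') (Sum.inl b) * h b z) =
      (sf * sf) * ∑' w, ∑ l' : Fin (d + 1), coDressKBmAt (toSite r) Lc (KInvStep (d := d) Lc (j + 1)) y w (Sum.inl l) (Sum.inl l') *
        ∑' z, ∑ b : Fin (d + 1), E2 d Lc (j + 1) w z (Sum.inl l') (Sum.inl b) * h b z := by
    rw [← tsum_mul_left]
    refine tsum_congr fun w => ?_
    rw [Finset.mul_sum]
    refine Finset.sum_congr rfl fun l' _ => ?_
    rw [unitK_apply, legScale_inl, legScale_inl]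
    ring
  rw [hin]
  ring

/-! ## §2 Re-indexing at period `Lc·N` -/

/-- [folklore] **THE DRESSED STEP KERNEL ON `Lc·N`-PERIODIC FIELD-LEG DATA IS `Lc·N`-PERIODIC** (block covariance `EEWordReduced.shiftK_dressedStep` with the shift `N•t`;
a re-indexing, no summability needed). -/
theorem dressedStep_apply_periodic_mul {r : Fin (d + 1) → ℕ} (sf sm : ℝ) (j N : ℕ) {h : Fin (d + 1) → Site (d + 1) → ℝ}
    (hh : ∀ b z t, h b (z + ((Lc * N : ℕ) : ℤ) • t) = h b z) (a : Fib d) (x t : Site (d + 1)) :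
    (∑' z, ∑ b : Fin (d + 1), unitK sf sm (coDressKBmAt (toSite r) Lc (KInvStep (d := d) Lc j)) (x + ((Lc * N : ℕ) : ℤ) • t) z a (Sum.inl b) * h b z) =
      ∑' z, ∑ b : Fin (d + 1), unitK sf sm (coDressKBmAt (toSite r) Lc (KInvStep (d := d) Lc j)) x z a (Sum.inl b) * h b z := by
  have hLc : 1 ≤ Lc := one_le_of_neZero Lc
  set X := unitK sf sm (coDressKBmAt (toSite r) Lc (KInvStep (d := d) Lc j)) with hXdef
  have hT : ((Lc * N : ℕ) : ℤ) • t = (Lc : ℤ) • ((N : ℤ) • t) := by rw [smul_smul, Nat.cast_mul]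
  rw [hT]
  have hX : ∀ (z : Site (d + 1)) (b : Fib d), X (x + (Lc : ℤ) • ((N : ℤ) • t)) z a b = X x (z - (Lc : ℤ) • ((N : ℤ) • t)) a b := by
    intro z b
    have h := congrFun (congrFun (congrFun (congrFun (shiftK_dressedStep (r := r) hLc sf sm j ((N : ℤ) • t)) (x + (Lc : ℤ) • ((N : ℤ) • t))) z) a) b
    rw [← hXdef] at h
    simp only [shiftK, add_neg_cancel_right] at h
    rw [← h, sub_eq_add_neg]
  simp_rw [hX]
  rw [← (Equiv.addRight ((Lc : ℤ) • ((N : ℤ) • t))).tsum_eq (fun z => ∑ b : Fin (d + 1), X x (z - (Lc : ℤ) • ((N : ℤ) • t)) a (Sum.inl b) * h b z)]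
  refine tsum_congr fun z => Finset.sum_congr rfl fun b _ => ?_
  simp only [Equiv.coe_addRight, add_sub_cancel_right]
  rw [← hT, hh]

omit [NeZero Lc] in
/-- [folklore] **BLOCK CONTOUR SUMS OF `Lc·N`-PERIODIC DATA ARE `N`-PERIODIC**: `(𝒬_{Lc} q)(κ, y + N•t) = (𝒬_{Lc} q)(κ, y)`. -/
theorem contourSum_translate_of_periodic (N : ℕ) {q : Fin (d + 1) → Site (d + 1) → ℝ} (hq : ∀ b z t, q b (z + ((Lc * N : ℕ) : ℤ) • t) = q b z)
    (κ : Fin (d + 1)) (y t : Site (d + 1)) : contourSum Lc q κ (y + (N : ℤ) • t) = contourSum Lc q κ y := by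
  unfold AffineAveraging.contourSum
  refine Finset.sum_congr rfl fun b _ => Finset.sum_congr rfl fun s _ => ?_
  rw [show (Lc : ℤ) • (y + (N : ℤ) • t) + toSite b + (s : ℤ) • unitVec κ
      = ((Lc : ℤ) • y + toSite b + (s : ℤ) • unitVec κ) + ((Lc * N : ℕ) : ℤ) • t by
      rw [smul_add, smul_smul, ← Nat.cast_mul]; abel, hq]

/-- [folklore] `E2` applied to `M`-periodic field-leg data is `M`-periodic (translation invariance of `E2`). -/
theorem E2_apply_translate_of_periodic (j : ℕ) (M : ℤ) {h : Fin (d + 1) → Site (d + 1) → ℝ} (hh : ∀ b z t, h b (z + M • t) = h b z)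
    (a : Fin (d + 1)) (x t : Site (d + 1)) :
    (∑' z, ∑ b : Fin (d + 1), E2 d Lc j (x + M • t) z (Sum.inl a) (Sum.inl b) * h b z) =
      ∑' z, ∑ b : Fin (d + 1), E2 d Lc j x z (Sum.inl a) (Sum.inl b) * h b z := by
  rw [← (Equiv.addRight (M • t)).tsum_eq (fun z => ∑ b : Fin (d + 1), E2 d Lc j (x + M • t) z (Sum.inl a) (Sum.inl b) * h b z)]
  refine tsum_congr fun z => Finset.sum_congr rfl fun b _ => ?_
  simp only [Equiv.coe_addRight, E2_inl_inl_translate, hh]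

/-- [folklore] The transposed reading: `y′ ↦ Σ'_{y″} Σ_{κ′} E2_{j}(y″, y′)_{κ′ m}·F κ′ y″` is `M`-periodic for `M`-periodic `F`. -/
theorem E2T_apply_translate_of_periodic (j : ℕ) (M : ℤ) {F : Fin (d + 1) → Site (d + 1) → ℝ} (hF : ∀ b z t, F b (z + M • t) = F b z)
    (m : Fin (d + 1)) (y' t : Site (d + 1)) :
    (∑' y'', ∑ κ' : Fin (d + 1), E2 d Lc j y'' (y' + M • t) (Sum.inl κ') (Sum.inl m) * F κ' y'') =
      ∑' y'', ∑ κ' : Fin (d + 1), E2 d Lc j y'' y' (Sum.inl κ') (Sum.inl m) * F κ' y'' := by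
  rw [← (Equiv.addRight (M • t)).tsum_eq (fun y'' => ∑ κ' : Fin (d + 1), E2 d Lc j y'' (y' + M • t) (Sum.inl κ') (Sum.inl m) * F κ' y'')]
  refine tsum_congr fun z => Finset.sum_congr rfl fun b _ => ?_
  simp only [Equiv.coe_addRight, E2_inl_inl_translate, hF]

/-! ## §3 The channel on the deep cell, tent kept -/

/-- [folklore] **THE VALUE OF THE E2–X̃–E2 CHANNEL ON THE `Lc·N`-CELL, TENT KEPT.** For `Lc·N`-periodic bounded field-leg profiles `qL`, `qR` (every `j`, in-block root
`toSite r`, every `N ≥ 1`): `Σ_{x ∈ box (Lc·N)} Σ_a (Σ'_y Σ_b E2_{j+1}(y,x)_{ba}·qL b y)·(Σ'_z Σ_b X̃_{j+1}(x,z)_{ab}·Σ'_s Σ_{b′} E2_{j+1}(z,s)_{b b′}·qR b′ s)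
= sf²·( wVH_{j+1}⁻¹·Σ_{x ∈ box (Lc·N)} Σ_b qL b x·Σ'_s Σ_{b′} E2_{j+1}(x,s)_{b b′}·qR b′ s
      − wVH_{j+1}⁻¹·Σ_{y ∈ box N} Σ_a (𝒬qL)(a,y)·Σ'_{y″} Σ_{κ′} E2_{j+2}(y″,y)_{κ′a}·(𝒬qR)(κ′,y″) )` — the gen-52 value plus the tent, read one level up. -/
theorem sum_box_E2T_mul_dressedStep_E2_apply_tent {r : Fin (d + 1) → ℕ} (hr : r ∈ box (d + 1) Lc) (sf sm : ℝ) (j N : ℕ) [NeZero N]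
    {qL qR : Fin (d + 1) → Site (d + 1) → ℝ} {B : ℝ}
    (hqLp : ∀ b y t, qL b (y + ((Lc * N : ℕ) : ℤ) • t) = qL b y) (hqRp : ∀ b y t, qR b (y + ((Lc * N : ℕ) : ℤ) • t) = qR b y)
    (hqLB : ∀ b y, |qL b y| ≤ B) (hqRB : ∀ b y, |qR b y| ≤ B) :
    ∑ x ∈ box (d + 1) (Lc * N), ∑ a : Fin (d + 1),
        (∑' y, ∑ b : Fin (d + 1), E2 d Lc (j + 1) y (toSite x) (Sum.inl b) (Sum.inl a) * qL b y) *
          ∑' z, ∑ b : Fin (d + 1), unitK sf sm (coDressKBmAt (toSite r) Lc (KInvStep (d := d) Lc (j + 1))) (toSite x) z (Sum.inl a) (Sum.inl b) *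
            ∑' s, ∑ b' : Fin (d + 1), E2 d Lc (j + 1) z s (Sum.inl b) (Sum.inl b') * qR b' s =
      (sf * sf) *
        ((wVH d Lc (j + 1))⁻¹ *
            ∑ x ∈ box (d + 1) (Lc * N), ∑ b : Fin (d + 1), qL b (toSite x) * ∑' s, ∑ b' : Fin (d + 1), E2 d Lc (j + 1) (toSite x) s (Sum.inl b) (Sum.inl b') * qR b' s -
          (wVH d Lc (j + 1))⁻¹ *
            ∑ y ∈ box (d + 1) N, ∑ a : Fin (d + 1), contourSum Lc qL a (toSite y) *
              ∑' y'', ∑ κ' : Fin (d + 1), E2 d Lc (j + 2) y'' (toSite y) (Sum.inl κ') (Sum.inl a) * contourSum Lc qR κ' y'') := by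
  haveI : NeZero (Lc * N) := ⟨Nat.mul_ne_zero (NeZero.ne Lc) (NeZero.ne N)⟩
  -- the inner `g := E2 qR`: periodic and bounded
  set g : Fin (d + 1) → Site (d + 1) → ℝ := fun b z => ∑' s, ∑ b' : Fin (d + 1), E2 d Lc (j + 1) z s (Sum.inl b) (Sum.inl b') * qR b' s with hgdef
  have hgp : ∀ b z t, g b (z + ((Lc * N : ℕ) : ℤ) • t) = g b z := fun b z t => E2_apply_translate_of_periodic (j + 1) _ hqRp b z t
  obtain ⟨δ, C, hδ, -, hE⟩ := decays_E2 (d := d) (Lc := Lc) (j + 1)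
  have hgB : ∀ b z, |g b z| ≤ ((d : ℝ) + 1) * (C * B) * Zl (d + 1) δ := fun b z => abs_apply_bdd_le hE hδ hqRB z (Sum.inl b)
  -- the right factor `Y := X̃ g`: periodic and bounded
  set Y : Fin (d + 1) → Site (d + 1) → ℝ :=
    fun a x => ∑' z, ∑ b : Fin (d + 1), unitK sf sm (coDressKBmAt (toSite r) Lc (KInvStep (d := d) Lc (j + 1))) x z (Sum.inl a) (Sum.inl b) * g b z with hYdef
  have hYp : ∀ a x t, Y a (x + ((Lc * N : ℕ) : ℤ) • t) = Y a x := fun a x t => dressedStep_apply_periodic_mul sf sm (j + 1) N hgp (Sum.inl a) x t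
  obtain ⟨δG, CG, hδG, -, hG⟩ := decays_coDressKBmAt_KInvStep (d := d) hr (j + 1)
  have hYu : ∀ a x, Y a x = (sf * sf) * ∑' z, ∑ b : Fin (d + 1), coDressKBmAt (toSite r) Lc (KInvStep (d := d) Lc (j + 1)) x z (Sum.inl a) (Sum.inl b) * g b z := by
    intro a x
    rw [hYdef, ← tsum_mul_left]
    refine tsum_congr fun z => ?_
    rw [Finset.mul_sum]
    refine Finset.sum_congr rfl fun b _ => ?_
    rw [unitK_apply, legScale_inl, legScale_inl]
    ring
  have hYB : ∀ a x, |Y a x| ≤ |sf * sf| * (((d : ℝ) + 1) * (CG * (((d : ℝ) + 1) * (C * B) * Zl (d + 1) δ)) * Zl (d + 1) δG) := by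
    intro a x
    rw [hYu, abs_mul]
    exact mul_le_mul_of_nonneg_left (abs_apply_bdd_le hG hδG hgB x (Sum.inl a)) (abs_nonneg _)
  -- a common bound
  set B' : ℝ := max B (|sf * sf| * (((d : ℝ) + 1) * (CG * (((d : ℝ) + 1) * (C * B) * Zl (d + 1) δ)) * Zl (d + 1) δG)) with hB'
  have hqLB' : ∀ b y, |qL b y| ≤ B' := fun b y => (hqLB b y).trans (le_max_left _ _)
  have hYB' : ∀ a x, |Y a x| ≤ B' := fun a x => (hYB a x).trans (le_max_right _ _)
  -- symmetry of `E2` on field legs: the left factor is `(E2 qL)(a, x)`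
  have hsym : ∀ (x : Fin (d + 1) → ℕ) (a : Fin (d + 1)), (∑' y, ∑ b : Fin (d + 1), E2 d Lc (j + 1) y (toSite x) (Sum.inl b) (Sum.inl a) * qL b y) =
      ∑' y, ∑ b : Fin (d + 1), E2 d Lc (j + 1) (toSite x) y (Sum.inl a) (Sum.inl b) * qL b y := by
    intro x a
    refine tsum_congr fun y => Finset.sum_congr rfl fun b _ => ?_
    rw [E2_inl_inl_eq_wΦ, E2_inl_inl_eq_wΦ, wΦ_symm]
    congr 2
    abel
  have hL : ∀ (x : Fin (d + 1) → ℕ) (a : Fin (d + 1)),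
      (∑' y, ∑ b : Fin (d + 1), E2 d Lc (j + 1) y (toSite x) (Sum.inl b) (Sum.inl a) * qL b y) *
          (∑' z, ∑ b : Fin (d + 1), unitK sf sm (coDressKBmAt (toSite r) Lc (KInvStep (d := d) Lc (j + 1))) (toSite x) z (Sum.inl a) (Sum.inl b) *
            ∑' s, ∑ b' : Fin (d + 1), E2 d Lc (j + 1) z s (Sum.inl b) (Sum.inl b') * qR b' s) =
        (∑' y, ∑ b : Fin (d + 1), E2 d Lc (j + 1) (toSite x) y (Sum.inl a) (Sum.inl b) * qL b y) * Y a (toSite x) := by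
    intro x a
    rw [hsym]
  simp_rw [hL]
  rw [sum_box_E2apply_mul_periodic' (Lc := Lc) (j + 1) hqLp hYp hqLB' hYB']
  -- the tent's coarse data `F := E2_{j+2}ᵀ(𝒬 qR)` is `N`-periodic
  set F : Fin (d + 1) → Site (d + 1) → ℝ :=
    fun m y' => ∑' y'', ∑ κ' : Fin (d + 1), E2 d Lc (j + 2) y'' y' (Sum.inl κ') (Sum.inl m) * contourSum Lc qR κ' y'' with hFdef
  have hFp : ∀ m y' t, F m (y' + (N : ℤ) • t) = F m y' :=
    fun m y' t => E2T_apply_translate_of_periodic (j + 2) _ (fun b z t => contourSum_translate_of_periodic N hqRp b z t) m y' t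
  -- the inner pairing is the sandwich through the units, tent kept
  have hin : ∀ (x : Fin (d + 1) → ℕ) (b : Fin (d + 1)),
      (∑' w, ∑ a : Fin (d + 1), E2 d Lc (j + 1) (toSite x) w (Sum.inl b) (Sum.inl a) * Y a w) =
        (sf * sf) * ((wVH d Lc (j + 1))⁻¹ * g b (toSite x) - (wVH d Lc (j + 1))⁻¹ * contourSumAdj Lc F b (toSite x)) :=
    fun x b => tsum_E2_unitK_E2_apply hr sf sm j hqRB (toSite x) b
  simp_rw [hin]
  -- split the two terms and move the tent onto the coarse cell
  have hsplit : ∀ (x : Fin (d + 1) → ℕ), (∑ b : Fin (d + 1), qL b (toSite x) *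
      ((sf * sf) * ((wVH d Lc (j + 1))⁻¹ * g b (toSite x) - (wVH d Lc (j + 1))⁻¹ * contourSumAdj Lc F b (toSite x)))) =
      (sf * sf) * ((wVH d Lc (j + 1))⁻¹ * ∑ b : Fin (d + 1), qL b (toSite x) * g b (toSite x)) -
        (sf * sf) * ((wVH d Lc (j + 1))⁻¹ * ∑ b : Fin (d + 1), qL b (toSite x) * contourSumAdj Lc F b (toSite x)) := by
    intro x
    rw [Finset.mul_sum, Finset.mul_sum, Finset.mul_sum, Finset.mul_sum, ← Finset.sum_sub_distrib]
    refine Finset.sum_congr rfl fun b _ => ?_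
    ring
  rw [Finset.sum_congr rfl fun x _ => hsplit x, Finset.sum_sub_distrib, ← Finset.mul_sum, ← Finset.mul_sum, ← Finset.mul_sum, ← Finset.mul_sum,
    sum_box_mul_contourSumAdj (L := Lc) (N := N) qL F hqLp hFp, ← mul_sub]

/-! ## §4 The tent on profiles with proportional block contour sums: the same pairing one level up -/

/-- [folklore] The transposed `E2_{j′}`-pairing is the direct one (symmetry of `E2` on field legs):
`Σ'_{y″} Σ_{κ′} E2_{j′}(y″,y)_{κ′a}·Q κ′ y″ = Σ'_{s} Σ_{b′} E2_{j′}(y,s)_{a b′}·Q b′ s`. -/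
theorem tsum_E2T_apply_eq (j' : ℕ) (Q : Fin (d + 1) → Site (d + 1) → ℝ) (a : Fin (d + 1)) (y : Site (d + 1)) :
    (∑' y'', ∑ κ' : Fin (d + 1), E2 d Lc j' y'' y (Sum.inl κ') (Sum.inl a) * Q κ' y'') =
      ∑' s, ∑ b' : Fin (d + 1), E2 d Lc j' y s (Sum.inl a) (Sum.inl b') * Q b' s := by
  refine tsum_congr fun s => Finset.sum_congr rfl fun b _ => ?_
  rw [E2_inl_inl_eq_wΦ, E2_inl_inl_eq_wΦ, wΦ_symm]
  congr 2
  abel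

/-- [folklore] **THE TENT ON PROFILES WITH PROPORTIONAL BLOCK CONTOUR SUMS IS THE SAME KIND OF PAIRING ONE LEVEL UP**: if `𝒬qL = c·QL` and `𝒬qR = c·QR`
pointwise, then `Σ_{y ∈ box N} Σ_a (𝒬qL)(a,y)·Σ'_{y″} Σ_{κ′} E2_{j+2}(y″,y)_{κ′a}·(𝒬qR)(κ′,y″) = c²·Σ_{y ∈ box N} Σ_a QL a y·Σ'_s Σ_{b′} E2_{j+2}(y,s)_{a b′}·QR b′ s`
(for the depth tower: `DeepProfileContourSum.contourSum_deepProfile` gives `c = Lc^{d+1}`, `Q = q^{(N)}` for `q = q^{(Lc·N)}`). -/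
theorem sum_box_tent_of_contourSum_eq (j N : ℕ) {qL qR QL QR : Fin (d + 1) → Site (d + 1) → ℝ} (c : ℝ)
    (hL : ∀ κ y, contourSum Lc qL κ y = c * QL κ y) (hR : ∀ κ y, contourSum Lc qR κ y = c * QR κ y) :
    ∑ y ∈ box (d + 1) N, ∑ a : Fin (d + 1), contourSum Lc qL a (toSite y) *
        ∑' y'', ∑ κ' : Fin (d + 1), E2 d Lc (j + 2) y'' (toSite y) (Sum.inl κ') (Sum.inl a) * contourSum Lc qR κ' y'' =
      (c * c) * ∑ y ∈ box (d + 1) N, ∑ a : Fin (d + 1), QL a (toSite y) *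
        ∑' s, ∑ b' : Fin (d + 1), E2 d Lc (j + 2) (toSite y) s (Sum.inl a) (Sum.inl b') * QR b' s := by
  rw [Finset.mul_sum]
  refine Finset.sum_congr rfl fun y _ => ?_
  rw [Finset.mul_sum]
  refine Finset.sum_congr rfl fun a _ => ?_
  have hin : (∑' y'', ∑ κ' : Fin (d + 1), E2 d Lc (j + 2) y'' (toSite y) (Sum.inl κ') (Sum.inl a) * contourSum Lc qR κ' y'') =
      c * ∑' s, ∑ b' : Fin (d + 1), E2 d Lc (j + 2) (toSite y) s (Sum.inl a) (Sum.inl b') * QR b' s := by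
    rw [← tsum_E2T_apply_eq (j + 2) QR a (toSite y), ← tsum_mul_left]
    refine tsum_congr fun y'' => ?_
    rw [Finset.mul_sum]
    refine Finset.sum_congr rfl fun κ' _ => ?_
    rw [hR]
    ring
  rw [hL, hin]
  ring

/-- [folklore] **THE LEVEL BRIDGE OF THE DEPTH TOWER** (K5 ∘ the proportionality of block contour sums): for `Lc·N`-periodic bounded field-leg profiles `qL`, `qR` with
`𝒬qL = c·QL`, `𝒬qR = c·QR`, the E2–X̃_{j+1}–E2 channel on the `Lc·N`-cell is
`sf²·( wVH_{j+1}⁻¹·⟨qL, E2_{j+1} qR⟩_{cell Lc·N} − wVH_{j+1}⁻¹·c²·⟨QL, E2_{j+2} QR⟩_{cell N} )` — the second pairing has the shape of the first, one level up. -/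
theorem sum_box_E2T_mul_dressedStep_E2_apply_bridge {r : Fin (d + 1) → ℕ} (hr : r ∈ box (d + 1) Lc) (sf sm : ℝ) (j N : ℕ) [NeZero N]
    {qL qR QL QR : Fin (d + 1) → Site (d + 1) → ℝ} {B : ℝ} (c : ℝ)
    (hqLp : ∀ b y t, qL b (y + ((Lc * N : ℕ) : ℤ) • t) = qL b y) (hqRp : ∀ b y t, qR b (y + ((Lc * N : ℕ) : ℤ) • t) = qR b y)
    (hqLB : ∀ b y, |qL b y| ≤ B) (hqRB : ∀ b y, |qR b y| ≤ B)
    (hL : ∀ κ y, contourSum Lc qL κ y = c * QL κ y) (hR : ∀ κ y, contourSum Lc qR κ y = c * QR κ y) :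
    ∑ x ∈ box (d + 1) (Lc * N), ∑ a : Fin (d + 1),
        (∑' y, ∑ b : Fin (d + 1), E2 d Lc (j + 1) y (toSite x) (Sum.inl b) (Sum.inl a) * qL b y) *
          ∑' z, ∑ b : Fin (d + 1), unitK sf sm (coDressKBmAt (toSite r) Lc (KInvStep (d := d) Lc (j + 1))) (toSite x) z (Sum.inl a) (Sum.inl b) *
            ∑' s, ∑ b' : Fin (d + 1), E2 d Lc (j + 1) z s (Sum.inl b) (Sum.inl b') * qR b' s =
      (sf * sf) *
        ((wVH d Lc (j + 1))⁻¹ *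
            ∑ x ∈ box (d + 1) (Lc * N), ∑ b : Fin (d + 1), qL b (toSite x) * ∑' s, ∑ b' : Fin (d + 1), E2 d Lc (j + 1) (toSite x) s (Sum.inl b) (Sum.inl b') * qR b' s -
          (wVH d Lc (j + 1))⁻¹ * ((c * c) *
            ∑ y ∈ box (d + 1) N, ∑ a : Fin (d + 1), QL a (toSite y) *
              ∑' s, ∑ b' : Fin (d + 1), E2 d Lc (j + 2) (toSite y) s (Sum.inl a) (Sum.inl b') * QR b' s)) := by
  rw [sum_box_E2T_mul_dressedStep_E2_apply_tent hr sf sm j N hqLp hqRp hqLB hqRB, sum_box_tent_of_contourSum_eq j N c hL hR]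

end Summit.QuantumFields.BalabanUV.Beta.GAN24.StepCovarianceCellPairingTent

end
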